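import Mathlib
import Literature.Probability.Percolation.SmoothedWhiteNoise
import Summits.CriticalPhenomena.CardyFormulaZ2.Theorems.CardyWhiteToColouredNoiseDiscretisationSignMeasurable
import Summits.CriticalPhenomena.CardyFormulaZ2.Theorems.CardyWhiteToColouredNoiseDiscretisationTail
import Summits.CriticalPhenomena.CardyFormulaZ2.Theorems.CardyWhiteToColouredDriftBoundStubWhiteEnd
import Summits.CriticalPhenomena.CardyFormulaZ2.Theorems.CardyWhiteToColouredDriftBoundStubSignLawPosAssoc

/-!
# Stub stub_openHalf — every lattice edge is open with probability `1/2`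
# (line `birth` of crux `DriftBound`)

Helper file for crux item `DriftBound` (stmt-CriticalPhenomena-4596) of route `CardyWhiteToColoured`
(`CardyFormulaZ2`), stub S5 of the registered line `Cruxes/DriftBound/Lines/birth.lean`
(skeleton v3): the row finite-energy input `p₀ = 1/2` of the uniform RSW glue.

For every width `σ > 0` and every lattice edge `e ∈ E(ℤ²)`, the sign law `signConfigLaw σ 1` of
the lattice white noise `ξ` (i.i.d. `N(0,1)` on `E(ℤ²)`) smoothed by the Gaussian kernel of width
`σ` at mesh `1` opens `e` with probability exactly `1/2`:

* the event `{e open}` pulls back to `{S > 0}`, `S(ξ) = ∑' e', q_σ(m e − m e') ξ_{e'}` the smoothed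
  field at the medial point `m e` of `e` (`Measure.map_apply`, measurability of `signConfig`);
* `ξ ↦ −ξ` preserves the product Gaussian measure (`Measure.infinitePi_map_pi`,
  `gaussianReal_map_neg`) and `S(−ξ) = −S(ξ)` (`tsum_neg`), so `P(S > 0) = P(S < 0)`;
* no ties, `P(S = 0) = 0` (`oh_ae_smoothedNoise_ne_zero`): almost surely the series converges
  absolutely (`pa_ae_summable_gaussWeight_mul_abs` of the positive-association stub: its
  expectation against `|ξ|` is `E|N(0,1)| · ∑' e', q_σ(m e − m e') < ∞`), so `S = ξ_e + T` with
  `T` the sum over the coordinates off `e` (the weight of `ξ_e` is `q_σ(0) = 1`), a measurable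
  function of `ξ|_{E ∖ {e}}`; the coordinate `ξ_e ∼ N(0,1)` is independent of `ξ|_{E ∖ {e}}`
  (`iIndepFun_infinitePi`, `indep_iSup_of_disjoint`), so the joint law of `(ξ_e, T)` is a product
  (`IndepFun.map_prod_eq_prod_map_map`) and `P(ξ_e + T = 0) = ∫ N(0,1){−t} dP_T(t) = 0`
  (`Measure.prod_apply_symm`; `N(0,1)` has no atoms);
* hence `2 P(S > 0) = P(S > 0) + P(S < 0) = 1 − P(S = 0) = 1`.

References: S. Muirhead, H. Vanneuville, Ann. Inst. H. Poincaré Probab. Stat. 56 (2020), §2.1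
(discretised white noise, `f^ε = q ⋆ W^ε`); G. Grimmett, *Percolation* (1999), §11.
-/

noncomputable section

namespace Summit.CriticalPhenomena.CardyFormulaZ2.Cruxes.DriftBound.Birth

open Set Filter Topology MeasureTheory ProbabilityTheory
open scoped ENNReal NNReal
open Literature.Probability.LatticeModels Literature.Probability.Percolation
open Summit.CriticalPhenomena.CardyFormulaZ2.Theorems.WhiteToColoured

/-- `Off[e]`: the index type of the noise coordinates other than `e`. -/
local notation3 "Off[" e "]" => ↥(({e} : Set ↥(zdGraph 2).edgeSet)ᶜ)

/-! ### One coordinate against the others: independence and no ties -/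

/-- **The coordinate `ξ_e` is independent of the other coordinates** `ξ|_{E ∖ {e}}` under the
lattice white noise (coordinates of a product measure over the disjoint index sets `{e}` and
`{e}ᶜ`: `iIndepFun_infinitePi` and `indep_iSup_of_disjoint`). -/
theorem oh_indepFun_eval_restrict (e : (zdGraph 2).edgeSet) :
    IndepFun (fun ξ : (zdGraph 2).edgeSet → ℝ => ξ e)
      (fun (ξ : (zdGraph 2).edgeSet → ℝ) (e' : Off[e]) => ξ e'.1) latticeWhiteNoise := by
  have hi : iIndepFun (fun (i : (zdGraph 2).edgeSet) (ξ : (zdGraph 2).edgeSet → ℝ) => ξ i)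
      latticeWhiteNoise :=
    iIndepFun_infinitePi (P := fun _ : (zdGraph 2).edgeSet => gaussianReal 0 1)
      (X := fun _ t => t) fun _ => measurable_id
  rw [iIndepFun_iff_iIndep] at hi
  have h := indep_iSup_of_disjoint (fun i => (measurable_pi_apply i).comap_le) hi
    (disjoint_compl_right (a := ({e} : Set (zdGraph 2).edgeSet)))
  rw [IndepFun_iff_Indep]
  refine indep_of_indep_of_le_right (indep_of_indep_of_le_left h ?_) ?_
  · exact le_iSup₂_of_le (f := fun (i : (zdGraph 2).edgeSet)
        (_ : i ∈ ({e} : Set (zdGraph 2).edgeSet)) =>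
      MeasurableSpace.comap (fun ξ : (zdGraph 2).edgeSet → ℝ => ξ i) inferInstance)
      e (mem_singleton e) le_rfl
  · refine (le_of_eq (MeasurableSpace.comap_process_pi
      (fun (e' : Off[e]) (ξ : (zdGraph 2).edgeSet → ℝ) => ξ e'.1))).trans (iSup_le fun e' => ?_)
    exact le_iSup₂_of_le (f := fun (i : (zdGraph 2).edgeSet)
        (_ : i ∈ ({e} : Set (zdGraph 2).edgeSet)ᶜ) =>
      MeasurableSpace.comap (fun ξ : (zdGraph 2).edgeSet → ℝ => ξ i) inferInstance)
      e'.1 e'.2 le_rfl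

/-- **No ties against an independent summand.** If `T` is a measurable function of the noise,
independent of the coordinate `ξ_e ∼ N(0,1)`, then `P(ξ_e + T = 0) = 0`: the joint law of
`(ξ_e, T)` is the product `N(0,1) ⊗ P_T` (`IndepFun.map_prod_eq_prod_map_map`,
`Measure.infinitePi_map_eval`), and each slice `{t | t + y = 0} = {−y}` is null for the atomless
`N(0,1)` (`Measure.prod_apply_symm`, `measure_singleton`). -/
theorem oh_measure_eval_add_eq_zero (e : (zdGraph 2).edgeSet) {T : ((zdGraph 2).edgeSet → ℝ) → ℝ}
    (hT : Measurable T)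
    (hind : IndepFun (fun ξ : (zdGraph 2).edgeSet → ℝ => ξ e) T latticeWhiteNoise) :
    latticeWhiteNoise {ξ | ξ e + T ξ = 0} = 0 := by
  have he : Measurable fun ξ : (zdGraph 2).edgeSet → ℝ => ξ e := measurable_pi_apply e
  have hlaw := hind.map_prod_eq_prod_map_map he.aemeasurable hT.aemeasurable
  rw [show latticeWhiteNoise.map (fun ξ : (zdGraph 2).edgeSet → ℝ => ξ e) = gaussianReal 0 1 from
    Measure.infinitePi_map_eval _ e] at hlaw
  have hA : MeasurableSet {p : ℝ × ℝ | p.1 + p.2 = 0} :=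
    measurableSet_eq_fun (measurable_fst.add measurable_snd) measurable_const
  have hpre : {ξ : (zdGraph 2).edgeSet → ℝ | ξ e + T ξ = 0} =
      (fun ξ => (ξ e, T ξ)) ⁻¹' {p : ℝ × ℝ | p.1 + p.2 = 0} := rfl
  rw [hpre, ← Measure.map_apply (he.prodMk hT) hA, hlaw, Measure.prod_apply_symm hA]
  haveI := nullSingletonClass_gaussianReal (μ := (0 : ℝ)) (v := 1) one_ne_zero
  have hslice : ∀ y : ℝ,
      gaussianReal 0 1 ((fun t : ℝ => (t, y)) ⁻¹' {p : ℝ × ℝ | p.1 + p.2 = 0}) = 0 := by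
    intro y
    refine measure_mono_null (fun t ht => ?_) (measure_singleton (-y))
    have ht' : t + y = 0 := ht
    show t = -y
    linarith
  simp only [hslice, lintegral_zero]

/-- **No ties (public, reused by the lead): the smoothed field at a medial point is a.s. non-zero.**
For `σ > 0` and a lattice edge `e`, `latticeWhiteNoise`-a.s. `F_{σ,1}(ξ)(m e) ≠ 0`: on the
full-measure set where the series converges absolutely (`pa_ae_summable_gaussWeight_mul_abs`),
`F(ξ)(m e) = ξ_e + T(ξ)` with `T` the (measurable) sum over the coordinates off `e`, independent of
`ξ_e` (`oh_indepFun_eval_restrict`), and `P(ξ_e + T = 0) = 0` (`oh_measure_eval_add_eq_zero`).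
(The self-duality stub proves the statement at every point `x` by resampling one coordinate,
`sd_ae_smoothedNoise_ne_zero`; this is the independence proof at medial points.) -/
theorem oh_ae_smoothedNoise_ne_zero {σ : ℝ} (hσ : 0 < σ) (e : (zdGraph 2).edgeSet) :
    ∀ᵐ ξ ∂latticeWhiteNoise, smoothedNoise σ 1 ξ (medialPoint 1 e.1) ≠ 0 := by
  -- the sum over the coordinates off `e`, as a function of the restricted noise and of the noise
  have hT' : Measurable fun η : Off[e] → ℝ =>
      ∑' e' : Off[e], gaussWeight σ (medialPoint 1 e.1 - medialPoint 1 e'.1.1) * η e' :=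
    Measurable.tsum fun e' => measurable_const.mul (measurable_pi_apply e')
  have hT : Measurable fun ξ : (zdGraph 2).edgeSet → ℝ =>
      ∑' e' : Off[e], gaussWeight σ (medialPoint 1 e.1 - medialPoint 1 e'.1.1) * ξ e'.1 :=
    hT'.comp (measurable_pi_lambda _ fun e' => measurable_pi_apply _)
  have hind : IndepFun (fun ξ : (zdGraph 2).edgeSet → ℝ => ξ e)
      (fun ξ : (zdGraph 2).edgeSet → ℝ =>
        ∑' e' : Off[e], gaussWeight σ (medialPoint 1 e.1 - medialPoint 1 e'.1.1) * ξ e'.1)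
      latticeWhiteNoise :=
    (oh_indepFun_eval_restrict e).comp measurable_id hT'
  have h0 := oh_measure_eval_add_eq_zero e hT hind
  filter_upwards [pa_ae_summable_gaussWeight_mul_abs hσ (medialPoint 1 e.1),
    measure_eq_zero_iff_ae_notMem.1 h0] with ξ hsum hne
  have hs : Summable fun e' : (zdGraph 2).edgeSet =>
      gaussWeight σ (medialPoint 1 e.1 - medialPoint 1 e'.1) * ξ e' :=
    Summable.of_norm (hsum.congr fun e' => by
      rw [Real.norm_eq_abs, abs_mul, abs_of_pos (gaussWeight_pos σ _)])
  have hsplit := hs.tsum_subtype_add_tsum_subtype_compl ({e} : Set (zdGraph 2).edgeSet)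
  rw [tsum_singleton e (fun e' : (zdGraph 2).edgeSet =>
    gaussWeight σ (medialPoint 1 e.1 - medialPoint 1 e'.1) * ξ e')] at hsplit
  have hw : gaussWeight σ (medialPoint 1 e.1 - medialPoint 1 e.1) = 1 := by
    simp [gaussWeight]
  rw [hw, one_mul] at hsplit
  rw [smoothedNoise_eq_tsum_gaussWeight, ← hsplit]
  exact hne

/-! ### Symmetry `ξ ↦ −ξ` and the conclusion -/

/-- The lattice white noise is invariant under `ξ ↦ −ξ` (each factor `N(0,1)` is symmetric,
`gaussianReal_map_neg`; `Measure.infinitePi_map_pi`). -/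
theorem oh_latticeWhiteNoise_map_neg :
    latticeWhiteNoise.map (fun ξ : (zdGraph 2).edgeSet → ℝ => -ξ) = latticeWhiteNoise := by
  have h := Measure.infinitePi_map_pi (μ := fun _ : (zdGraph 2).edgeSet => gaussianReal 0 1)
    (f := fun _ (t : ℝ) => -t) fun _ => measurable_neg
  simp only [gaussianReal_map_neg, neg_zero] at h
  exact h

/-- The smoothed field is odd in the noise: `F(−ξ) = −F(ξ)` (unconditionally, `tsum_neg`). -/
theorem oh_smoothedNoise_neg (ℓ δ : ℝ) (ξ : (zdGraph 2).edgeSet → ℝ) (x : ℂ) :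
    smoothedNoise ℓ δ (-ξ) x = -smoothedNoise ℓ δ ξ x := by
  simp only [smoothedNoise, Pi.neg_apply, mul_neg, tsum_neg]

/-- **From symmetry and no ties to one half.** For a measurable real statistic `S` under a
probability measure with `P(S > 0) = P(S < 0)` and `P(S = 0) = 0`, `P(S > 0) = 1/2`. -/
theorem oh_measureReal_pos_eq_half {Ω : Type*} [MeasurableSpace Ω] (μ : Measure Ω)
    [IsProbabilityMeasure μ] {S : Ω → ℝ} (hS : Measurable S)
    (hsymm : μ.real {ω | 0 < S ω} = μ.real {ω | S ω < 0}) (h0 : μ.real {ω | S ω = 0} = 0) :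
    μ.real {ω | 0 < S ω} = 1 / 2 := by
  have hpos : MeasurableSet {ω | 0 < S ω} := measurableSet_lt measurable_const hS
  have h4 : μ.real {ω | 0 < S ω} + μ.real {ω | 0 < S ω}ᶜ = 1 := by
    rw [measureReal_add_measureReal_compl hpos, probReal_univ]
  have hsub1 : {ω | 0 < S ω}ᶜ ⊆ {ω | S ω < 0} ∪ {ω | S ω = 0} := by
    intro ω hω
    simp only [mem_compl_iff, mem_setOf_eq, not_lt] at hω
    simp only [mem_union, mem_setOf_eq]
    exact hω.lt_or_eq
  have hsub2 : {ω | S ω < 0} ⊆ {ω | 0 < S ω}ᶜ := by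
    intro ω hω
    simp only [mem_compl_iff, mem_setOf_eq, not_lt] at hω ⊢
    exact hω.le
  have h5 : μ.real {ω | 0 < S ω}ᶜ = μ.real {ω | S ω < 0} := by
    refine le_antisymm ?_ (measureReal_mono hsub2)
    calc μ.real {ω | 0 < S ω}ᶜ ≤ μ.real ({ω | S ω < 0} ∪ {ω | S ω = 0}) := measureReal_mono hsub1
      _ ≤ μ.real {ω | S ω < 0} + μ.real {ω | S ω = 0} := measureReal_union_le _ _
      _ = μ.real {ω | S ω < 0} := by rw [h0, add_zero]
  linarith

/-- **Stub S5 — every edge is open with probability `1/2`.** For `σ > 0` and every lattice edge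
`e ∈ E(ℤ²)`, `signConfigLaw σ 1 {ω | e ∈ ω} = 1/2`: the event pulls back to `{F(ξ)(m e) > 0}`
(`Measure.map_apply`, `measurable_signConfig`), whose probability equals that of `{F(ξ)(m e) < 0}`
by the symmetry `ξ ↦ −ξ` (`oh_latticeWhiteNoise_map_neg`, `oh_smoothedNoise_neg`), while
`{F(ξ)(m e) = 0}` is null (`oh_ae_smoothedNoise_ne_zero`); conclude with
`oh_measureReal_pos_eq_half`. -/
theorem stub_openHalf :
    ∀ σ : ℝ, 0 < σ → ∀ e ∈ (Literature.Probability.LatticeModels.zdGraph 2).edgeSet,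
      (Literature.Probability.Percolation.signConfigLaw σ 1).real {ω | e ∈ ω} = 1 / 2 := by
  intro σ hσ e he
  have hS : Measurable fun ξ : (zdGraph 2).edgeSet → ℝ => smoothedNoise σ 1 ξ (medialPoint 1 e) :=
    measurable_smoothedNoise σ 1 _
  have hpos :
      MeasurableSet {ξ : (zdGraph 2).edgeSet → ℝ | 0 < smoothedNoise σ 1 ξ (medialPoint 1 e)} :=
    measurableSet_lt measurable_const hS
  -- (1) pull the event back to the noise
  have h1 : (signConfigLaw σ 1).real {ω | e ∈ ω} =
      latticeWhiteNoise.real {ξ | 0 < smoothedNoise σ 1 ξ (medialPoint 1 e)} := by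
    rw [signConfigLaw, measureReal_def, measureReal_def,
      Measure.map_apply (measurable_signConfig σ 1) (measurableSet_mem e)]
    congr 2
    ext ξ
    simp only [mem_preimage, mem_setOf_eq, mem_signConfig_iff, he, true_and]
  -- (2) symmetry
  have h2 : latticeWhiteNoise.real {ξ | 0 < smoothedNoise σ 1 ξ (medialPoint 1 e)} =
      latticeWhiteNoise.real {ξ | smoothedNoise σ 1 ξ (medialPoint 1 e) < 0} := by
    have h := Measure.map_apply (μ := latticeWhiteNoise)
      (f := fun ξ : (zdGraph 2).edgeSet → ℝ => -ξ) measurable_neg hpos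
    rw [oh_latticeWhiteNoise_map_neg] at h
    rw [measureReal_def, measureReal_def, h]
    congr 2
    ext ξ
    simp only [mem_preimage, mem_setOf_eq, oh_smoothedNoise_neg, neg_pos]
  -- (3) no ties
  have h3 : latticeWhiteNoise.real {ξ | smoothedNoise σ 1 ξ (medialPoint 1 e) = 0} = 0 := by
    rw [measureReal_eq_zero_iff]
    have h := ae_iff.1 (oh_ae_smoothedNoise_ne_zero hσ ⟨e, he⟩)
    simpa only [ne_eq, not_not] using h
  rw [h1]
  exact oh_measureReal_pos_eq_half latticeWhiteNoise hS h2 h3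

end Summit.CriticalPhenomena.CardyFormulaZ2.Cruxes.DriftBound.Birth

end
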